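import Summits.QuantumFields.YangMills.Theorems.FluctuationComparisonRegPrIntLPersistenceSigmaFree
import Literature.MathematicalPhysics.QuantumFieldTheory.Balaban1983to89.T3HeightwiseDensityBounds
import HarnessLib

/-!
# `FluctuationComparisonRegPrIntLPersistenceFromHeightwiseBounds` — LINE g22-2∕g22-4, row PERS₁∘ `OneLevelPersistenceIntCan`: THE `K`-UNIFORM LETTERS ⟨UP⟩ ∕ ⟨LOW⟩ OF
# THE σ-FREE PATH ARE BAŁABAN'S HEIGHTWISE STABILITY BOUNDS (5)∕(6) OF CMP 102 IN THE TREE'S TYPED SCHEMA CURRENCY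
# (crux `UnitScaleTilt.FluctuationComparisonRegPrIntL`, stmt-QuantumFields-20520; companion of ✓`…PersistenceSigmaFree` (PERS₁∘ ⟸ ⟨UP⟩ + ⟨LOW on S′⟩ + ⟨SMALL-MASS₁(S′)⟩) and of
# lit `Balaban1983to89.T3HeightwiseDensityBounds` (the heightwise `K`-uniform density schemas `HeightwiseUpperBound`, `HeightwiseLowerBoundOnSmall`))

Cell `ym3-torus` (YM ladder rung R3 = continuum SU(2) Yang–Mills on T³ — a RUNG, NOT the Clay problem: not d = 4, not infinite volume, not a mass gap);
width seat `ym-ust-20520-w3` (gen 18, LEAD-20520); helper `--supports stmt-QuantumFields-20520`.  THEOREMS ONLY (0 `def`, 0 `sorry`, default heartbeats).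

WHY.  ✓`…PersistenceSigmaFree` reduced PERS₁∘ to two `K`-UNIFORM measure inequalities on the run-`K` law of level `J+1`, `ν_K := (Gibbs_K).map D_{J+1,K}`, against product Haar —
⟨UP⟩ `ν_K⌊D⁻¹W_J(c·b₀) ≤ C·dU_{J+1}⌊D⁻¹W_J(c·b₀)` and ⟨LOW on S′⟩ `cl·dU_{J+1}⌊S′ ≤ ν_K⌊S′` (`S′ = W_{J+1}(c·b₀)`) — plus the K-free ⟨SMALL-MASS₁(S′)⟩.  The tree's literature layer
ALREADY TYPES the `K`-uniform content, in the quotient currency `Z_K⁻¹ρ_{K−n}` (the density of `ν_K` against `dU_n`, lit ✓`map_descendTo_restrict_eq_withDensity`):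
lit `T3HeightwiseDensityBounds.HeightwiseUpperBound F γ` = [Balaban1985UV3] (5) upper at height `n` over (6) (Thm 1 p. 257; Bałaban's `E_K` cancels), and the lower half of (5) on
small fields, `HeightwiseLowerBoundOnSmall`.  THIS FILE docks them:
* §1 ★★`up_of_heightwiseUpperBound` — `HeightwiseUpperBound F γ` (`γ ≥ 0`) ⟹ ⟨UP⟩ at every `(J, K)` with ONE constant per `J` (lit ✓`map_descendTo_le_smul_fieldMeasure`, restriction).
* §2 ★★`low_of_heightwiseLowerDensity` — a `K`-UNIFORM a.e. lower bound `cl ≤ Z_K⁻¹ρ_{K−(J+1)}` on `S′` ⟹ ⟨LOW on S′⟩ (`withDensity` monotonicity on the restricted measure);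
  ★`low_of_heightwiseLowerBoundOnSmall` — from the schema `HeightwiseLowerBoundOnSmall F γ` whenever its plaquette threshold `δ_{J+1}` covers the window, `θ_{J+1}(c·b₀) ≤ δ_{J+1}`.
* §3 ★★★`oneLevelPersistenceIntCan_of_heightwiseBounds_smallMass : ⟨HeightwiseUpperBound + the lower density bound on S′ (after F, γ, J; before K)⟩ + ⟨SMALL-MASS₁(S′)⟩ → PERS₁∘
  VERBATIM` (✓`oneLevelPersistenceIntCan_of_up_low_smallMass`).
SO, for the census: PERS₁∘'s `K`-uniform debt is EXACTLY «CMP 102 (5)∕(6) at height `K−J−1` for the pinned `ℰp` densities» — the typed schemas `HeightwiseUpperBound` (upper∕(6))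
and the lower half of (5) read on the level-`(J+1)` interior window — i.e. pub-balaban3d's end theorem ∕ route UVClassRigidity's `stub_heightwiseCompactness` input, NOT a new
letter; the K-free debt is ⟨SMALL-MASS₁(S′)⟩ (px8 ∕ px20 ∕ w4 hands).
HONEST SCOPE.  Doors; `HeightwiseUpperBound`, the lower density bound and ⟨SMALL-MASS₁⟩ are the HYPOTHESES — Bałaban's Theorem 1 is NOT proved here, nor PERS₁∘, POS∘, LFR♯ᶜ∘, S2β,
20520; `YM3TorusSU2` NOT proved; the Yang–Mills mass gap is NOT proved.
HYP-SAT (cell RULING №42).  `HeightwiseUpperBound F γ` ∕ the lower bound are predicates in `(F, γ)` with constants after `n = J+1` and before `K` — printed for Bałaban's run objects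
(Thm 1 p. 257), the cell's construction statement for the pinned `ℰp` densities (lit module docstring); the compatibility `θ_{J+1}(c·b₀) ≤ δ_{J+1}` of §2b is a READING of (4)'s
fixed threshold `ε₁` against the γ-small window, displayed, not proved.
References: [Balaban1985UV3] (4)–(6) pp. 256–257, Thm 1 p. 257, (47) p. 267; [Balaban1985Averaging] (10) p. 19, Prop. 1 p. 22; [Balaban1987RG1] (0.18)–(0.22) p. 255.
-/

noncomputable section

set_option autoImplicit false

open MeasureTheory Filter Topology Set
open scoped ENNReal NNReal
open Literature.MathematicalPhysics.QuantumFieldTheory.Balaban1983to89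
open Literature.MathematicalPhysics.QuantumFieldTheory.Balaban1983to89.T3ContinuumYM3Torus
open Literature.MathematicalPhysics.QuantumFieldTheory.Balaban1983to89.T3NestedUnitLaws
open Literature.MathematicalPhysics.QuantumFieldTheory.Balaban1983to89.T3UnitLawDensityEML
open Literature.MathematicalPhysics.QuantumFieldTheory.Balaban1983to89.T3UnitScaleTilt
open Literature.MathematicalPhysics.QuantumFieldTheory.Balaban1983to89.T3TiltDescent
open Literature.MathematicalPhysics.QuantumFieldTheory.Balaban1983to89.T3HeightwiseDensityBounds
open Literature.MathematicalPhysics.QuantumFieldTheory.Balaban1983to89.Missing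
open Literature.MathematicalPhysics.QuantumFieldTheory.Balaban1983to89.T4Continuum

namespace Summit.QuantumFields.YangMills.Theorems.FluctuationComparisonRegPrIntLPersistenceFromHeightwiseBounds

variable (F : T3Family) {γ : ℝ}

/-! ## §1 ⟨UP⟩ from Bałaban's heightwise upper bound (5)∕(6) -/

/-- ★★ **⟨UP⟩ ⟸ `HeightwiseUpperBound`**: under the heightwise `K`-uniform upper stability bound of the normalised density (lit schema = [Balaban1985UV3] (5) upper at height
`J+1` over (6)), for every `J` there is ONE real `C > 0` such that for EVERY run `K ≥ J+1` and every set `A` of level-`(J+1)` fields: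
`((Gibbs_K).map D_{J+1,K})⌊A ≤ ofReal C • dU_{J+1}⌊A` — in particular ⟨UP⟩ of ✓`…PersistenceSigmaFree` (`A := D⁻¹W_J(c·b₀)`).  (Lit ✓`map_descendTo_le_smul_fieldMeasure` +
restriction.) [cite: Balaban1985UV3, (5) p.256, (6) p.257, Thm 1 p.257] -/
theorem up_of_heightwiseUpperBound (hγ : 0 ≤ γ) (h : HeightwiseUpperBound F γ) (J : ℕ) :
    ∃ C : ℝ, 0 < C ∧ ∀ (K : ℕ) (hJK : J + 1 ≤ K) (A : Set (GaugeField (F.P (J + 1)) 0 (Matrix.specialUnitaryGroup (Fin 2) ℂ))),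
      ((gibbsK F ℰp γ K).map (descendTo F ℰp (J + 1) K hJK)).restrict A ≤
        ENNReal.ofReal C • (fieldMeasure (F.P (J + 1)) 0 (Matrix.specialUnitaryGroup (Fin 2) ℂ)).restrict A := by
  obtain ⟨C, hC0, hC⟩ := map_descendTo_le_smul_fieldMeasure (F := F) hγ h (J + 1)
  refine ⟨C + 1, by linarith, fun K hJK A => ?_⟩
  have hle : (gibbsK F ℰp γ K).map (descendTo F ℰp (J + 1) K hJK) ≤
      ENNReal.ofReal (C + 1) • fieldMeasure (F.P (J + 1)) 0 (Matrix.specialUnitaryGroup (Fin 2) ℂ) :=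
    (hC K hJK).trans (Measure.le_iff'.mpr fun s => by
      simp only [Measure.smul_apply, smul_eq_mul]
      exact mul_le_mul_left (ENNReal.ofReal_le_ofReal (by linarith)) _)
  calc ((gibbsK F ℰp γ K).map (descendTo F ℰp (J + 1) K hJK)).restrict A
      ≤ (ENNReal.ofReal (C + 1) • fieldMeasure (F.P (J + 1)) 0 (Matrix.specialUnitaryGroup (Fin 2) ℂ)).restrict A :=
        Measure.restrict_mono le_rfl hle
    _ = ENNReal.ofReal (C + 1) • (fieldMeasure (F.P (J + 1)) 0 (Matrix.specialUnitaryGroup (Fin 2) ℂ)).restrict A := Measure.restrict_smul _ _ _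

/-! ## §2 ⟨LOW on S′⟩ from a heightwise lower density bound on the interior window -/

/-- ★★ **⟨LOW on S⟩ ⟸ A `K`-UNIFORM LOWER DENSITY BOUND ON `S`**: if for a measurable set `S` of level-`(J+1)` fields and a constant `cl` the normalised height density satisfies
`cl ≤ Z_K⁻¹·ρ_{K−(J+1)}` `dU_{J+1}`-a.e. on `S` for a run `K ≥ J+1` ([Balaban1985UV3] (5), lower half, read on `S`), then `ofReal cl • dU_{J+1}⌊S ≤ ((Gibbs_K).map D_{J+1,K})⌊S` — ⟨LOW on S⟩ of
✓`…PersistenceSigmaFree`.  (The descended law IS `dU_{J+1}.withDensity (Z_K⁻¹ρ)`, lit ✓`map_descendTo_restrict_eq_withDensity`; `withDensity` monotonicity under restriction.)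
[cite: Balaban1985UV3, (5) p.256, (6) p.257 and (47) p.267] -/
theorem low_of_heightwiseLowerDensity (hγ : 0 ≤ γ) {J K : ℕ} (hJK : J + 1 ≤ K)
    {S : Set (GaugeField (F.P (J + 1)) 0 (Matrix.specialUnitaryGroup (Fin 2) ℂ))} (hS : MeasurableSet S) {cl : ℝ}
    (h : ∀ᵐ V ∂(fieldMeasure (F.P (J + 1)) 0 (Matrix.specialUnitaryGroup (Fin 2) ℂ)), V ∈ S →
      cl ≤ (partitionFn (G := Matrix.specialUnitaryGroup (Fin 2) ℂ) (F.P K) ((F.scheme ℰp γ).β K))⁻¹ * heightDensity F γ hJK Set.univ V) :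
    ENNReal.ofReal cl • (fieldMeasure (F.P (J + 1)) 0 (Matrix.specialUnitaryGroup (Fin 2) ℂ)).restrict S ≤
      ((gibbsK F ℰp γ K).map (descendTo F ℰp (J + 1) K hJK)).restrict S := by
  have hmap := map_descendTo_restrict_eq_withDensity F hJK MeasurableSet.univ hγ
  rw [Measure.restrict_univ] at hmap
  rw [hmap, restrict_withDensity hS, ← withDensity_const]
  refine withDensity_mono ((ae_restrict_iff' hS).mpr ?_)
  filter_upwards [h] with V hV hVS
  exact ENNReal.ofReal_le_ofReal (hV hVS)

/-- ★ **⟨LOW on the interior window⟩ ⟸ `HeightwiseLowerBoundOnSmall`, WHEN ITS THRESHOLD COVERS THE WINDOW**: if the schema's plaquette threshold `δ` at height `J+1` dominates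
the window radius, `θ_{J+1}(c·b₀) ≤ δ`, then for every run `K ≥ J+1`: `ofReal c' • dU_{J+1}⌊S′ ≤ ((Gibbs_K).map D_{J+1,K})⌊S′`, `S′ = {PlaqSmall θ_{J+1}(c·b₀)}` (the compatibility is a
READING of (4)'s fixed `ε₁` against the γ-small window — displayed, not proved). [cite: Balaban1985UV3, (4)-(5) p.256 and (47) p.267] -/
theorem low_of_heightwiseLowerBoundOnSmall (hγ : 0 ≤ γ) (c b₀ p₀ : ℝ) {J : ℕ} {δ cl : ℝ}
    (hδ : θBal F.L γ (c * b₀) p₀ (J + 1) ≤ δ)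
    (h : ∀ (K : ℕ) (hK : J + 1 ≤ K), ∀ᵐ V ∂(fieldMeasure (F.P (J + 1)) 0 (Matrix.specialUnitaryGroup (Fin 2) ℂ)), PlaqSmall δ V →
      cl ≤ (partitionFn (G := Matrix.specialUnitaryGroup (Fin 2) ℂ) (F.P K) ((F.scheme ℰp γ).β K))⁻¹ * heightDensity F γ hK Set.univ V)
    (K : ℕ) (hJK : J + 1 ≤ K) :
    ENNReal.ofReal cl • (fieldMeasure (F.P (J + 1)) 0 (Matrix.specialUnitaryGroup (Fin 2) ℂ)).restrict
        {V | PlaqSmall (θBal F.L γ (c * b₀) p₀ (J + 1)) V} ≤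
      ((gibbsK F ℰp γ K).map (descendTo F ℰp (J + 1) K hJK)).restrict {V | PlaqSmall (θBal F.L γ (c * b₀) p₀ (J + 1)) V} := by
  refine low_of_heightwiseLowerDensity F hγ hJK (measurableSet_plaqSmall _) ?_
  filter_upwards [h K hJK] with V hV hVS
  exact hV (fun p => (hVS p).trans_le hδ)

/-! ## §3 The knit: heightwise (5)∕(6) bounds + ⟨SMALL-MASS₁(S′)⟩ ⇒ PERS₁∘ verbatim -/

/-- ★★★ **PERS₁∘ `OneLevelPersistenceIntCan` VERBATIM ⟸ BAŁABAN'S HEIGHTWISE STABILITY BOUNDS + ⟨SMALL-MASS₁(S′)⟩.**  Hypothesis, in PERS₁∘'s shared prefix: after `F, γ` —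
(i) `HeightwiseUpperBound F γ` (lit schema: [Balaban1985UV3] (5) upper ∕ (6), `K`-uniform at every height); for every `J` — (ii) a `K`-UNIFORM lower density bound on the level-`(J+1)`
INTERIOR window: `∃ cl > 0, ∀ K ≥ J+1, dU_{J+1}`-a.e. on `S′ = {PlaqSmall θ_{J+1}(c·b₀)}`, `cl ≤ Z_K⁻¹·ρ_{K−(J+1)}` ((5) lower half read on `S′`); (iii) ⟨SMALL-MASS₁(S′)⟩ — the K-free
one-step Haar kinematics of ✓`…PersistenceSigmaFree`.  Conclusion: PERS₁∘ byte for byte (§1, §2, ✓`oneLevelPersistenceIntCan_of_up_low_smallMass`; the prefix's `γ₁` is capped at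
`1` only to have `0 ≤ γ`).  SO PERS₁∘'s `K`-uniform debt is EXACTLY CMP 102 Theorem 1's heightwise reading for the pinned `ℰp` densities — no new letter.
HONEST SCOPE: a door; (i)–(iii) are HYPOTHESES; Theorem 1 is NOT proved here. [cite: Balaban1985UV3, (5) p.256, (6) p.257, Thm 1 p.257; Balaban1985Averaging, Prop. 1 p.22] -/
theorem oneLevelPersistenceIntCan_of_heightwiseBounds_smallMass
    (h : ∀ (L : ℕ), ∃ c₀ : ℝ, 0 < c₀ ∧ c₀ ≤ 1 ∧ ∀ (c : ℝ), 0 < c → c ≤ c₀ → ∃ pS : ℝ, ∀ (b₀ p₀ : ℝ), 0 < b₀ → pS ≤ p₀ → 0 < p₀ →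
      ∃ γ₁ : ℝ, 0 < γ₁ ∧ ∀ (F : T3Family) (γ : ℝ), F.L = L → 0 < γ → γ ≤ γ₁ →
        HeightwiseUpperBound F γ ∧
        ∀ (J : ℕ),
          (∃ cl : ℝ, 0 < cl ∧ ∀ (K : ℕ) (hJK : J + 1 ≤ K),
            ∀ᵐ V ∂(fieldMeasure (F.P (J + 1)) 0 (Matrix.specialUnitaryGroup (Fin 2) ℂ)), PlaqSmall (θBal F.L γ (c * b₀) p₀ (J + 1)) V →
              cl ≤ (partitionFn (G := Matrix.specialUnitaryGroup (Fin 2) ℂ) (F.P K) ((F.scheme ℰp γ).β K))⁻¹ * heightDensity F γ hJK Set.univ V) ∧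
          (∃ q₀ : ℝ, 0 < q₀ ∧ ∀ (B : Set (GaugeField (F.P J) 0 (Matrix.specialUnitaryGroup (Fin 2) ℂ))), MeasurableSet B →
            B ⊆ {U | PlaqSmall (θBal F.L γ (c * b₀) p₀ J) U} →
            ENNReal.ofReal q₀ * fieldMeasure (F.P (J + 1)) 0 (Matrix.specialUnitaryGroup (Fin 2) ℂ) (descendTo F ℰp J (J + 1) (Nat.le_succ J) ⁻¹' B) ≤
              fieldMeasure (F.P (J + 1)) 0 (Matrix.specialUnitaryGroup (Fin 2) ℂ) (descendTo F ℰp J (J + 1) (Nat.le_succ J) ⁻¹' B ∩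
                {V | PlaqSmall (θBal F.L γ (c * b₀) p₀ (J + 1)) V}))) :
    ∀ (L : ℕ), ∃ c₀ : ℝ, 0 < c₀ ∧ c₀ ≤ 1 ∧ ∀ (c : ℝ), 0 < c → c ≤ c₀ → ∃ pS : ℝ, ∀ (b₀ p₀ : ℝ), 0 < b₀ → pS ≤ p₀ → 0 < p₀ →
      ∃ γ₁ : ℝ, 0 < γ₁ ∧ ∀ (F : T3Family) (γ : ℝ), F.L = L → 0 < γ → γ ≤ γ₁ →
        ∀ (J : ℕ), ∃ q : ℝ, 0 < q ∧ ∀ (K : ℕ) (hJK : J + 1 ≤ K)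
          (B : Set (GaugeField (F.P J) 0 (Matrix.specialUnitaryGroup (Fin 2) ℂ))), MeasurableSet B →
            B ⊆ {U | PlaqSmall (θBal F.L γ (c * b₀) p₀ J) U} →
            ENNReal.ofReal q * gibbsK F ℰp γ K (descendTo F ℰp J K ((Nat.le_succ J).trans hJK) ⁻¹' B) ≤
              gibbsK F ℰp γ K (descendTo F ℰp J K ((Nat.le_succ J).trans hJK) ⁻¹' B ∩
                descendTo F ℰp (J + 1) K hJK ⁻¹' {V | PlaqSmall (θBal F.L γ (c * b₀) p₀ (J + 1)) V}) := by
  refine Summit.QuantumFields.YangMills.Theorems.FluctuationComparisonRegPrIntLPersistenceSigmaFree.oneLevelPersistenceIntCan_of_up_low_smallMass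
    fun L => ?_
  obtain ⟨c₀, hc₀, hc₀1, hc⟩ := h L
  refine ⟨c₀, hc₀, hc₀1, fun c hcpos hcle => ?_⟩
  obtain ⟨pS, hpS⟩ := hc c hcpos hcle
  refine ⟨pS, fun b₀ p₀ hb₀ hpS' hp₀ => ?_⟩
  obtain ⟨γ₁, hγ₁, hγ₁F⟩ := hpS b₀ p₀ hb₀ hpS' hp₀
  refine ⟨γ₁, hγ₁, fun F γ hFL hγ hγle J => ?_⟩
  obtain ⟨hup, hJ⟩ := hγ₁F F γ hFL hγ hγle
  obtain ⟨⟨cl, hcl, hlow⟩, hSM⟩ := hJ J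
  obtain ⟨C, hC, hUP⟩ := up_of_heightwiseUpperBound F hγ.le hup J
  refine ⟨⟨C, cl, hC, hcl, fun K hJK => ⟨hUP K hJK _, ?_⟩⟩, hSM⟩
  exact low_of_heightwiseLowerDensity F hγ.le hJK (measurableSet_plaqSmall _) (hlow K hJK)

end Summit.QuantumFields.YangMills.Theorems.FluctuationComparisonRegPrIntLPersistenceFromHeightwiseBounds

end
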